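import Mathlib
import Literature.Probability.Percolation.PercolationEvents
import Literature.Probability.Percolation.SharpnessDCTProofs
import Literature.Probability.LatticeModels.ProdBernoulliIndependence
import HarnessLib

/-!
# MAXATT implies `NearOneGluing`

Stub `stub_maxattGlue` of line `SketchR2I5` (cycle 4) for the crux `PercNearOneGluing.NearOneGluing`
(item stmt-CriticalPhenomena-4574 = Kozma–Nitzan Conjecture 3 over all finite weighted graphs).

Setting: one finite weighted graph — vertices `Fin n`, weights `w`, `μ = prodBernoulli w` on bond configurations
`ω : Set (Sym2 (Fin n))`; relay set `A`, source `o`, target `b`; `u(v) := μ(v ↮ b) = μ.real (openConn v b)ᶜ`;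
for a relay `a`, the attachment event `Att a := openConnIn (insert a (↑A)ᶜ) o a` (`a` is reached from `o` by an open
path all of whose other vertices avoid `A`), and the lexicographic selection event
`Sel a := Att a ∩ {every attached a' has (u a', a') ≤ₗₑₓ (u a, a)}`.

The HYPOTHESIS of `stub_maxattGlue` is the lead's conjectural MAXATT inequality (registered as the stub
`stub_maxattGluing`), verbatim: for `o ∉ A ∋ b`, `μ{o ↮ b ∧ ∃ a ∈ A, Att a} ≤ Σ_{a ∈ A} u(a) · μ(Sel a)`.

The CONCLUSION is `NearOneGluing` (unfolded), with `δ := ε / 3`: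
* `maxattGlue_sel_pairwiseDisjoint`, `maxattGlue_sum_sel_le_one`: two selected relays beat each other
  lexicographically, so they coincide; hence `Σ_a μ(Sel a) ≤ 1`;
* `maxattGlue_exists_attached`: an open `o–a` path (`a ∈ B ∌ o`) meets `B` first at some `y`, and its initial
  segment attaches `y`: `ω ∈ openConnIn (insert y (↑B)ᶜ) o y`;
* `stub_maxattGlue`: if `o = b` or `o ∈ A` the conclusion is immediate; otherwise apply MAXATT to
  `B := insert b A` (`o ∉ B ∋ b`): every factor `u(a)`, `a ∈ B`, is `≤ δ` (`u(b) = 0`), so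
  `μ{o ↮ b ∧ ∃ a ∈ B, Att a} ≤ δ · Σ_a μ(Sel a) ≤ δ`, and `{o ↮ b} ⊆ {o ↮ A} ∪ {o ↮ b ∧ ∃ a ∈ B, Att a}` by the
  first-hit lemma; total `μ(o ↮ b) < δ + δ < ε`.
-/

namespace Summit.CriticalPhenomena.PercolationContinuityZ3.Theorems

open MeasureTheory Set Literature.Probability.LatticeModels Literature.Probability.Percolation
open scoped Classical BigOperators

section MaxattGlue

/-- **The lexicographic selection events are pairwise disjoint.**  With
`Sel a := Att a ∩ {∀ a' ∈ A, Att a' → (u a' < u a ∨ (u a' = u a ∧ a' ≤ a))}`, two relays `a₁ ≠ a₂` of `A` cannot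
both be selected at the same `ω`: each would beat the other in the lexicographic order on `(u ·, ·)`. -/
theorem maxattGlue_sel_pairwiseDisjoint {Ω α : Type*} [LinearOrder α] (A : Finset α) (Att : α → Set Ω)
    (u : α → ℝ) :
    PairwiseDisjoint (↑A : Set α) (fun a => {ω : Ω | ω ∈ Att a ∧
      ∀ a' ∈ A, ω ∈ Att a' → (u a' < u a ∨ (u a' = u a ∧ a' ≤ a))}) := by
  intro a₁ ha₁ a₂ ha₂ hne
  refine Set.disjoint_left.2 fun ω h₁ h₂ => hne ?_
  obtain ⟨hAtt₁, hsel₁⟩ := h₁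
  obtain ⟨hAtt₂, hsel₂⟩ := h₂
  rcases hsel₁ a₂ ha₂ hAtt₂ with hlt | ⟨heq, hle⟩
  · rcases hsel₂ a₁ ha₁ hAtt₁ with hlt' | ⟨heq', -⟩
    · exact absurd (hlt.trans hlt') (lt_irrefl _)
    · exact absurd (heq'.symm ▸ hlt) (lt_irrefl _)
  · rcases hsel₂ a₁ ha₁ hAtt₁ with hlt' | ⟨-, hle'⟩
    · exact absurd (heq ▸ hlt') (lt_irrefl _)
    · exact le_antisymm hle' hle

/-- **The selection probabilities sum to at most one:** the events `Sel a`, `a ∈ A`, are pairwise disjoint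
(`maxattGlue_sel_pairwiseDisjoint`), so under a probability (or zero) measure `Σ_{a ∈ A} μ(Sel a) ≤ 1`. -/
theorem maxattGlue_sum_sel_le_one {Ω α : Type*} [MeasurableSpace Ω] [DiscreteMeasurableSpace Ω] [LinearOrder α]
    (μ : Measure Ω) [IsZeroOrProbabilityMeasure μ] (A : Finset α) (Att : α → Set Ω) (u : α → ℝ) :
    ∑ a ∈ A, μ.real {ω : Ω | ω ∈ Att a ∧ ∀ a' ∈ A, ω ∈ Att a' → (u a' < u a ∨ (u a' = u a ∧ a' ≤ a))} ≤ 1 := by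
  rw [← measureReal_biUnion_finset (maxattGlue_sel_pairwiseDisjoint A Att u)
    (fun _ _ => MeasurableSet.of_discrete)]
  exact measureReal_le_one

/-- **First hit of the relay set is attached.**  If `o ∉ B ∋ a` and `ω ∈ {o ↔ a}`, follow an open `o–a` path up to
its first vertex `y` in `B`: the initial segment avoids `B`, so `ω ∈ {o ↔ y inside insert y (↑B)ᶜ}`. -/
theorem maxattGlue_exists_attached {V : Type*} {B : Finset V} {o a : V} {ω : BondConfig V} (ho : o ∉ B)
    (ha : a ∈ B) (h : ω ∈ (openConn o a : Set (BondConfig V))) :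
    ∃ y ∈ B, ω ∈ (openConnIn (insert y ((↑B : Set V)ᶜ)) o y : Set (BondConfig V)) := by
  obtain ⟨x, y, -, hy, -, hxy, hp⟩ := (DCT16.pathIn_univ_of_reachable h).exit (R := (↑B : Set V)ᶜ)
    (fun h' => ho (Finset.mem_coe.1 h')) (fun h' => h' (Finset.mem_coe.2 ha))
  refine ⟨y, Finset.mem_coe.1 (Set.notMem_compl_iff.1 hy),
    DCT16.mem_openConnIn_of_pathIn ((hp.mono ?_).tail hxy (Set.mem_insert _ _))⟩
  exact fun v hv => Set.mem_insert_of_mem _ hv.1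

/-- **MAXATT implies the crux** (stub `stub_maxattGlue` of line `SketchR2I5`, cycle 4).
The hypothesis is the registered MAXATT inequality `stub_maxattGluing` verbatim; the conclusion is `NearOneGluing`
unfolded, with `δ = ε / 3`.  Proof: for an instance with `o ≠ b`, `o ∉ A` apply the hypothesis to `B := insert b A`
(`o ∉ B ∋ b`): `μ{o ↮ b ∧ ∃ a ∈ B, Att a} ≤ Σ_{a ∈ B} μ(a ↮ b) · μ(Sel a) ≤ (ε/3) · Σ_a μ(Sel a) ≤ ε/3`
(`μ(b ↮ b) = 0`, `maxattGlue_sum_sel_le_one`), and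
`μ(o ↮ b) ≤ μ(o ↮ A) + μ{o ↮ b ∧ ∃ a ∈ B, Att a} < ε/3 + ε/3 < ε` (`maxattGlue_exists_attached`).  If `o = b` the
conclusion is `μ(univ) = 1 > 1 - ε`; if `o ∈ A` it is the hypothesis at `a = o`. -/
theorem stub_maxattGlue :
    (∀ (n : ℕ) (w : Sym2 (Fin n) → unitInterval) (A : Finset (Fin n)) (o b : Fin n), o ∉ A → b ∈ A →
      (prodBernoulli w).real {ω | ω ∉ openConn o b ∧
          ∃ a ∈ A, ω ∈ openConnIn (insert a ((↑A : Set (Fin n))ᶜ)) o a} ≤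
        ∑ a ∈ A, (prodBernoulli w).real (openConn a b)ᶜ *
          (prodBernoulli w).real {ω | ω ∈ openConnIn (insert a ((↑A : Set (Fin n))ᶜ)) o a ∧
            ∀ a' ∈ A, ω ∈ openConnIn (insert a' ((↑A : Set (Fin n))ᶜ)) o a' →
              ((prodBernoulli w).real (openConn a' b)ᶜ < (prodBernoulli w).real (openConn a b)ᶜ ∨
                ((prodBernoulli w).real (openConn a' b)ᶜ = (prodBernoulli w).real (openConn a b)ᶜ ∧ a' ≤ a))}) →
    -- conclusion = `PercNearOneGluing.NearOneGluing` UNFOLDED (so that this stub is not mistaken for the skeleton's crux theorem)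
    ∀ ε : ℝ, 0 < ε → ∃ δ : ℝ, 0 < δ ∧ ∀ (n : ℕ) (w : Sym2 (Fin n) → unitInterval) (A : Finset (Fin n)) (o b : Fin n),
      1 - δ < (prodBernoulli w).real (⋃ a ∈ A, openConn o a) →
      (∀ a ∈ A, 1 - δ < (prodBernoulli w).real (openConn a b)) → 1 - ε < (prodBernoulli w).real (openConn o b) := by
  intro hMax ε hε
  refine ⟨ε / 3, by positivity, ?_⟩
  intro n w A o b hoA hab
  let μ := prodBernoulli w
  change 1 - ε / 3 < μ.real (⋃ a ∈ A, openConn o a) at hoA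
  change ∀ a ∈ A, 1 - ε / 3 < μ.real (openConn a b) at hab
  change 1 - ε < μ.real (openConn o b)
  -- the case `o = b`: `{o ↔ o} = univ`
  by_cases hob : o = b
  · subst hob
    have huniv : (openConn o o : Set (Set (Sym2 (Fin n)))) = univ :=
      Set.eq_univ_of_forall fun _ => SimpleGraph.Reachable.refl _
    rw [huniv, probReal_univ]
    linarith
  -- the case `o ∈ A` is a hypothesis
  by_cases ho : o ∈ A
  · have := hab o ho
    linarith
  -- the main case: apply MAXATT to `B := insert b A`
  let B : Finset (Fin n) := insert b A
  have hoB : o ∉ B := fun h => (Finset.mem_insert.1 h).elim hob ho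
  have hbB : b ∈ B := Finset.mem_insert_self b A
  let Att : Fin n → Set (Set (Sym2 (Fin n))) := fun a => openConnIn (insert a ((↑B : Set (Fin n))ᶜ)) o a
  let u : Fin n → ℝ := fun a => μ.real (openConn a b)ᶜ
  let Sel : Fin n → Set (Set (Sym2 (Fin n))) := fun a =>
    {ω | ω ∈ Att a ∧ ∀ a' ∈ B, ω ∈ Att a' → (u a' < u a ∨ (u a' = u a ∧ a' ≤ a))}
  have hineq : μ.real {ω | ω ∉ openConn o b ∧ ∃ a ∈ B, ω ∈ Att a} ≤ ∑ a ∈ B, u a * μ.real (Sel a) :=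
    hMax n w B o b hoB hbB
  -- every unreliability factor is at most `ε / 3` (`u b = 0`)
  have hu : ∀ a ∈ B, u a ≤ ε / 3 := by
    intro a ha
    change μ.real (openConn a b)ᶜ ≤ ε / 3
    rcases Finset.mem_insert.1 ha with rfl | haA
    · have hempty : (openConn a a : Set (Set (Sym2 (Fin n))))ᶜ = ∅ :=
        Set.compl_empty_iff.2 (Set.eq_univ_of_forall fun _ => SimpleGraph.Reachable.refl _)
      rw [hempty, measureReal_empty]
      positivity
    · rw [probReal_compl_eq_one_sub MeasurableSet.of_discrete]
      have := hab a haA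
      linarith
  have hbad : μ.real {ω | ω ∉ openConn o b ∧ ∃ a ∈ B, ω ∈ Att a} ≤ ε / 3 := by
    refine hineq.trans ?_
    calc ∑ a ∈ B, u a * μ.real (Sel a)
        ≤ ∑ a ∈ B, (ε / 3) * μ.real (Sel a) :=
          Finset.sum_le_sum fun a ha => mul_le_mul_of_nonneg_right (hu a ha) measureReal_nonneg
      _ = (ε / 3) * ∑ a ∈ B, μ.real (Sel a) := (Finset.mul_sum _ _ _).symm
      _ ≤ (ε / 3) * 1 :=
          mul_le_mul_of_nonneg_left (maxattGlue_sum_sel_le_one μ B Att u) (by positivity)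
      _ = ε / 3 := mul_one _
  -- bookkeeping
  have hcomplA : μ.real (⋃ a ∈ A, openConn o a)ᶜ < ε / 3 := by
    rw [probReal_compl_eq_one_sub MeasurableSet.of_discrete]
    linarith
  have hcover : (openConn o b : Set (Set (Sym2 (Fin n))))ᶜ ⊆
      (⋃ a ∈ A, openConn o a)ᶜ ∪ {ω | ω ∉ openConn o b ∧ ∃ a ∈ B, ω ∈ Att a} := by
    intro ω hω
    by_cases hA : ω ∈ ⋃ a ∈ A, openConn o a
    · right
      refine ⟨hω, ?_⟩
      simp only [Set.mem_iUnion, exists_prop] at hA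
      obtain ⟨a, haA, hωa⟩ := hA
      exact maxattGlue_exists_attached hoB (Finset.mem_insert_of_mem haA) hωa
    · left
      exact hA
  have hBad : μ.real (openConn o b)ᶜ < ε := by
    calc μ.real (openConn o b)ᶜ
        ≤ μ.real ((⋃ a ∈ A, openConn o a)ᶜ ∪ {ω | ω ∉ openConn o b ∧ ∃ a ∈ B, ω ∈ Att a}) :=
          measureReal_mono hcover (measure_ne_top _ _)
      _ ≤ μ.real (⋃ a ∈ A, openConn o a)ᶜ + μ.real {ω | ω ∉ openConn o b ∧ ∃ a ∈ B, ω ∈ Att a} :=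
          measureReal_union_le _ _
      _ < ε / 3 + ε / 3 := add_lt_add_of_lt_of_le hcomplA hbad
      _ ≤ ε := by linarith
  have hfin : μ.real (openConn o b) = 1 - μ.real (openConn o b)ᶜ := by
    rw [probReal_compl_eq_one_sub (μ := μ) (s := openConn o b) MeasurableSet.of_discrete]
    ring
  rw [hfin]
  linarith

end MaxattGlue

end Summit.CriticalPhenomena.PercolationContinuityZ3.Theorems
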